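import Mathlib

/-!
# Sketch (lens-3 g10; rev 2 g11; rev 3 g12) — the assembly of Part III §3 / §7 / §7bis as a well-founded induction

Abstract levels `Λ` (regular local models `T` along the DD arc in exceptional normal form), an admissible
blow-up relation `step`, the pole order `pole : Λ → ℕ` (= N) and the horizontal distance `dplus : Λ → ℕ`
(= d⁺ of the conormal lattice).  Conjecture D⁺ is the hypothesis `hD`; the conclusion is that every level
reaches a released level (`pole L' ≤ r`, r = 1 for e = p, r = 0 for f = p) through finitely many admissible
blow-ups.  Nothing here is specific to resolution; it is the logical skeleton of Theorem 7.1 of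
`Cruxes/DescentPerfectToAll/Lines/valuative-constant-step-normalmodule.md`.

rev 2 (g11, workfile rev 7 §7bis): Conjecture D⁺ with the potential `(N, d⁺)` is FALSE as stated (7bis.1: an
isolated additive level where the forced point blow-up keeps `N` and raises `d⁺`).  The corrected potential is
`Φ = (N, rk B₀, μ, d⁺)` (μ = 1 at a non-maximal level, 0 otherwise), Theorem 7bis.3′.  The second half of this
file packages that theorem abstractly: `PhiLT`, its well-foundedness, `reaches_released_phi`, and
`phiDecreases_of_cases`, whose three hypotheses are exactly the three step types (B) `rk B₀ = 0 → point`
(5.1(i): N drops), (M) `maximal → 7.3-centre` (N drops, or rank drops, or rank and maximality kept and d⁺ drops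
by rk B₀ — 7.3, 5.9), (NM) `non-maximal → point` (5.8: N, rank kept, the new level maximal).  counted 0;
nothing here proves resolution in characteristic p.

rev 3 (g12, workfile rev 8): `PhiDecreases` (Φ ∈ ℕ⁴ with `Prod.Lex`, rev 2) IS the typed replacement of the refuted
`ConjDPlus` asked for in TRIAGE-136 (P4); `ConjDPlus` is kept only as the rev-1 form, false as stated.  New in rev 3:
the e = p END-GAME of Lemma 3.2 (at pole order `N = 1` the derivation is of multiplicative type, some eigen-divisor
blow-up either releases or keeps `N = 1` and lowers `σ = Σ rep λᵢ ∈ ℕ`) packaged as `SigmaStep`, its termination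
`endgame_releases` (induction on σ), and the TWO-PHASE WALK `reaches_pole_zero`: Φ-descent through the additive
levels (`N ≥ 2`, Theorem 7bis.3′) followed by σ-descent through the multiplicative ones (`N = 1`, Lemma 3.2) reaches
a level with `N = 0`, i.e. `∂(T) ⊆ T` — the released level of Part III §1 whose ring of constants is the regular model
sought.  Still 0 sorries, still only the logical skeleton: the three hypotheses are the paper theorems, not Lean ones.
rev 4 (g12): section `OrbitDistance` — Theorem 7bis.3″ of the supplement §6.15 in abstract form: with the orbit
distance as a primitive `K` the walk reaches pole order ≤ 1 within `N + 2K − 1` steps (amortised potential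
`pole + 2K − credit`), using neither rank monotonicity nor «r′ = r ⇒ maximal».
-/

namespace Summit.ResolutionOfSingularities.ResolutionOfSingularities.Cruxes.DescentPerfectToAll.ConormalWalk

/-- The potential (N, d⁺) of a level, ordered lexicographically. -/
def potential {Λ : Type*} (pole dplus : Λ → ℕ) (L : Λ) : ℕ × ℕ := (pole L, dplus L)

/-- `LexLT pole dplus L' L` : the potential of `L'` is lexicographically below that of `L`. -/
def LexLT {Λ : Type*} (pole dplus : Λ → ℕ) (L' L : Λ) : Prop :=
  Prod.Lex (· < ·) (· < ·) (potential pole dplus L') (potential pole dplus L)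

theorem lexLT_wf {Λ : Type*} (pole dplus : Λ → ℕ) : WellFounded (LexLT pole dplus) :=
  InvImage.wf (potential pole dplus) (WellFounded.prod_lex wellFounded_lt wellFounded_lt)

/-- CONJECTURE D⁺ as a hypothesis on an abstract walk: from every non-released level some admissible
step lowers `(pole, dplus)` lexicographically. -/
def ConjDPlus {Λ : Type*} (step : Λ → Λ → Prop) (pole dplus : Λ → ℕ) (r : ℕ) : Prop :=
  ∀ L, r < pole L → ∃ L', step L L' ∧ LexLT pole dplus L' L

/-- FIRST LEMMA (Theorem 7.1, skeleton; proved): Conjecture D⁺ implies that every level reaches a released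
level (`pole ≤ r`) by a finite chain of admissible steps. -/
theorem reaches_released {Λ : Type*} (step : Λ → Λ → Prop) (pole dplus : Λ → ℕ) (r : ℕ)
    (hD : ConjDPlus step pole dplus r) :
    ∀ L, ∃ L', Relation.ReflTransGen step L L' ∧ pole L' ≤ r := by
  intro L
  induction L using (lexLT_wf pole dplus).induction with
  | _ L ih =>
    by_cases h : pole L ≤ r
    · exact ⟨L, Relation.ReflTransGen.refl, h⟩
    · obtain ⟨L', hs, hlt⟩ := hD L (lt_of_not_ge h)
      obtain ⟨L'', h1, h2⟩ := ih L' hlt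
      exact ⟨L'', Relation.ReflTransGen.head hs h1, h2⟩

/-- The two proved pieces of §5 packaged abstractly: point blow-ups at `B₀ = 0` lower the pole order,
admissible centres never raise it; hence D⁺ only has to be supplied at NILPOTENT levels (`B₀ ≠ 0`). -/
theorem conjDPlus_of_nilpotent_case {Λ : Type*} (step : Λ → Λ → Prop) (pole dplus : Λ → ℕ) (r : ℕ)
    (B0zero : Λ → Prop)
    (hPoint : ∀ L, r < pole L → B0zero L → ∃ L', step L L' ∧ pole L' < pole L)
    (hNil : ∀ L, r < pole L → ¬ B0zero L → ∃ L', step L L' ∧ LexLT pole dplus L' L) :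
    ConjDPlus step pole dplus r := by
  intro L hL
  by_cases hB : B0zero L
  · obtain ⟨L', hs, hlt⟩ := hPoint L hL hB
    exact ⟨L', hs, Prod.Lex.left _ _ hlt⟩
  · exact hNil L hL hB


/-! ## rev 2 (g11): the corrected potential Φ = (N, rk B₀, μ, d⁺) of Theorem 7bis.3′ -/

/-- Φ(L) = (N, rk B₀, μ, d⁺) as a nested pair. -/
def phi {Λ : Type*} (pole rk mu dplus : Λ → ℕ) (L : Λ) : ℕ × (ℕ × (ℕ × ℕ)) :=
  (pole L, (rk L, (mu L, dplus L)))

/-- `PhiLT … L' L` : Φ(L') is lexicographically below Φ(L). -/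
def PhiLT {Λ : Type*} (pole rk mu dplus : Λ → ℕ) (L' L : Λ) : Prop :=
  Prod.Lex (· < ·) (Prod.Lex (· < ·) (Prod.Lex (· < ·) (· < ·)))
    (phi pole rk mu dplus L') (phi pole rk mu dplus L)

theorem phiLT_wf {Λ : Type*} (pole rk mu dplus : Λ → ℕ) : WellFounded (PhiLT pole rk mu dplus) :=
  InvImage.wf (phi pole rk mu dplus)
    (WellFounded.prod_lex wellFounded_lt
      (WellFounded.prod_lex wellFounded_lt (WellFounded.prod_lex wellFounded_lt wellFounded_lt)))

theorem phiLT_of_pole_lt {Λ : Type*} (pole rk mu dplus : Λ → ℕ) {L' L : Λ}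
    (h : pole L' < pole L) : PhiLT pole rk mu dplus L' L :=
  Prod.Lex.left _ _ h

theorem phiLT_of_rk_lt {Λ : Type*} (pole rk mu dplus : Λ → ℕ) {L' L : Λ}
    (hp : pole L' = pole L) (h : rk L' < rk L) : PhiLT pole rk mu dplus L' L := by
  unfold PhiLT phi; rw [hp]; exact Prod.Lex.right _ (Prod.Lex.left _ _ h)

theorem phiLT_of_mu_lt {Λ : Type*} (pole rk mu dplus : Λ → ℕ) {L' L : Λ}
    (hp : pole L' = pole L) (hr : rk L' = rk L) (h : mu L' < mu L) :
    PhiLT pole rk mu dplus L' L := by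
  unfold PhiLT phi; rw [hp, hr]; exact Prod.Lex.right _ (Prod.Lex.right _ (Prod.Lex.left _ _ h))

theorem phiLT_of_dplus_lt {Λ : Type*} (pole rk mu dplus : Λ → ℕ) {L' L : Λ}
    (hp : pole L' = pole L) (hr : rk L' = rk L) (hm : mu L' = mu L) (h : dplus L' < dplus L) :
    PhiLT pole rk mu dplus L' L := by
  unfold PhiLT phi; rw [hp, hr, hm]
  exact Prod.Lex.right _ (Prod.Lex.right _ (Prod.Lex.right _ h))

/-- THEOREM 7bis.3′ as a hypothesis on an abstract walk: from every non-released level some admissible step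
lowers Φ. -/
def PhiDecreases {Λ : Type*} (step : Λ → Λ → Prop) (pole rk mu dplus : Λ → ℕ) (r : ℕ) : Prop :=
  ∀ L, r < pole L → ∃ L', step L L' ∧ PhiLT pole rk mu dplus L' L

/-- Φ-version of the assembly (proved): if Φ decreases along admissible steps, every level reaches a released
level by a finite chain of admissible steps. -/
theorem reaches_released_phi {Λ : Type*} (step : Λ → Λ → Prop) (pole rk mu dplus : Λ → ℕ) (r : ℕ)
    (hΦ : PhiDecreases step pole rk mu dplus r) :
    ∀ L, ∃ L', Relation.ReflTransGen step L L' ∧ pole L' ≤ r := by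
  intro L
  induction L using (phiLT_wf pole rk mu dplus).induction with
  | _ L ih =>
    by_cases h : pole L ≤ r
    · exact ⟨L, Relation.ReflTransGen.refl, h⟩
    · obtain ⟨L', hs, hlt⟩ := hΦ L (lt_of_not_ge h)
      obtain ⟨L'', h1, h2⟩ := ih L' hlt
      exact ⟨L'', Relation.ReflTransGen.head hs h1, h2⟩

/-- The three step types of the canonical walk (workfile 7bis.3′) imply that Φ decreases:
(B) at `rk B₀ = 0` the point blow-up lowers `N` (5.1(i));
(M) at a maximal level (`mu = 0`, `rk ≠ 0`) the blow-up of the 7.3-centre either lowers `N`, or keeps `N` and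
lowers the rank, or keeps `N`, rank and maximality and lowers `d⁺` (by `rk B₀`; 7.3 + 5.9);
(NM) at a non-maximal level (`mu ≠ 0`) the point blow-up keeps `N` and the rank and lands on a maximal level
(5.8). -/
theorem phiDecreases_of_cases {Λ : Type*} (step : Λ → Λ → Prop) (pole rk mu dplus : Λ → ℕ) (r : ℕ)
    (hB : ∀ L, r < pole L → rk L = 0 → ∃ L', step L L' ∧ pole L' < pole L)
    (hM : ∀ L, r < pole L → rk L ≠ 0 → mu L = 0 → ∃ L', step L L' ∧
      (pole L' < pole L ∨ (pole L' = pole L ∧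
        (rk L' < rk L ∨ (rk L' = rk L ∧ mu L' = 0 ∧ dplus L' < dplus L)))))
    (hNM : ∀ L, r < pole L → rk L ≠ 0 → mu L ≠ 0 → ∃ L', step L L' ∧
      pole L' = pole L ∧ rk L' = rk L ∧ mu L' = 0) :
    PhiDecreases step pole rk mu dplus r := by
  intro L hL
  by_cases h0 : rk L = 0
  · obtain ⟨L', hs, hlt⟩ := hB L hL h0
    exact ⟨L', hs, phiLT_of_pole_lt pole rk mu dplus hlt⟩
  · by_cases hm : mu L = 0
    · obtain ⟨L', hs, h⟩ := hM L hL h0 hm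
      refine ⟨L', hs, ?_⟩
      rcases h with hlt | ⟨hp, h'⟩
      · exact phiLT_of_pole_lt pole rk mu dplus hlt
      · rcases h' with hrk | ⟨hr, hmu, hd⟩
        · exact phiLT_of_rk_lt pole rk mu dplus hp hrk
        · exact phiLT_of_dplus_lt pole rk mu dplus hp hr (by rw [hmu, hm]) hd
    · obtain ⟨L', hs, hp, hr, hmu⟩ := hNM L hL h0 hm
      exact ⟨L', hs, phiLT_of_mu_lt pole rk mu dplus hp hr (by omega)⟩

/-- Dimension three (Theorem 7bis.3): with `rk ≡ 1` at additive levels with `B₀ ≠ 0` and `mu = ι` (isolated),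
the same statement with the potential `(N, ι, d⁺)` — a special case of `phiDecreases_of_cases`. -/
theorem reaches_released_dim3 {Λ : Type*} (step : Λ → Λ → Prop) (pole rk iota dplus : Λ → ℕ) (r : ℕ)
    (hB : ∀ L, r < pole L → rk L = 0 → ∃ L', step L L' ∧ pole L' < pole L)
    (hDiv : ∀ L, r < pole L → rk L ≠ 0 → iota L = 0 → ∃ L', step L L' ∧
      (pole L' < pole L ∨ (pole L' = pole L ∧ rk L' = rk L ∧ iota L' = 0 ∧ dplus L' < dplus L)))
    (hIso : ∀ L, r < pole L → rk L ≠ 0 → iota L ≠ 0 → ∃ L', step L L' ∧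
      pole L' = pole L ∧ rk L' = rk L ∧ iota L' = 0) :
    ∀ L, ∃ L', Relation.ReflTransGen step L L' ∧ pole L' ≤ r := by
  refine reaches_released_phi step pole rk iota dplus r
    (phiDecreases_of_cases step pole rk iota dplus r hB ?_ hIso)
  intro L hL h0 hm
  obtain ⟨L', hs, h⟩ := hDiv L hL h0 hm
  refine ⟨L', hs, ?_⟩
  rcases h with hlt | ⟨hp, hr, hi, hd⟩
  · exact Or.inl hlt
  · exact Or.inr ⟨hp, Or.inr ⟨hr, hi, hd⟩⟩


/-! ## rev 3 (g12, workfile rev 8 Lemma 3.2): the `N = 1` endgame and the two-phase walk to `N = 0` -/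

/-- LEMMA 3.2 as a hypothesis on an abstract walk (regime e = p): from every level of pole order `1` some
admissible step either releases (`pole = 0`) or keeps pole order `1` and lowers `sigma` (= Σᵢ rep λᵢ, the sum of
the representatives in `{0,…,p-1}` of the eigenvalues of the residue matrix `B₀`, which satisfies `B₀^p = B₀`). -/
def SigmaStep {Λ : Type*} (step : Λ → Λ → Prop) (pole sigma : Λ → ℕ) : Prop :=
  ∀ L, pole L = 1 → ∃ L', step L L' ∧ (pole L' = 0 ∨ (pole L' = 1 ∧ sigma L' < sigma L))

/-- Termination of the endgame (proved): under `SigmaStep` every level of pole order `1` reaches a level of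
pole order `0` by finitely many admissible steps (induction on `sigma`). -/
theorem endgame_releases {Λ : Type*} (step : Λ → Λ → Prop) (pole sigma : Λ → ℕ)
    (hσ : SigmaStep step pole sigma) :
    ∀ L, pole L = 1 → ∃ L', Relation.ReflTransGen step L L' ∧ pole L' = 0 := by
  intro L
  induction L using (InvImage.wf sigma wellFounded_lt).induction with
  | _ L ih =>
    intro hL
    obtain ⟨L', hs, h⟩ := hσ L hL
    rcases h with h0 | ⟨h1, hlt⟩
    · exact ⟨L', Relation.ReflTransGen.single hs, h0⟩
    · obtain ⟨L'', h1', h2'⟩ := ih L' hlt h1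
      exact ⟨L'', Relation.ReflTransGen.head hs h1', h2'⟩

/-- A quantitative form (proved): the endgame needs at most `sigma L` steps.  `stepsTo step n L L'` : `L'` is
reached from `L` in at most `n` admissible steps. -/
def stepsTo {Λ : Type*} (step : Λ → Λ → Prop) : ℕ → Λ → Λ → Prop
  | 0, L, L' => L' = L
  | n + 1, L, L' => L' = L ∨ ∃ M, step L M ∧ stepsTo step n M L'

theorem stepsTo_mono {Λ : Type*} (step : Λ → Λ → Prop) :
    ∀ {m n : ℕ} {L L' : Λ}, m ≤ n → stepsTo step m L L' → stepsTo step n L L' := by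
  intro m n
  induction n generalizing m with
  | zero =>
    intro L L' hmn h
    have : m = 0 := Nat.le_zero.mp hmn
    subst this; exact h
  | succ n ihn =>
    intro L L' hmn h
    cases m with
    | zero => exact Or.inl h
    | succ m =>
      rcases h with h | ⟨M, hs, hM⟩
      · exact Or.inl h
      · exact Or.inr ⟨M, hs, ihn (Nat.succ_le_succ_iff.mp hmn) hM⟩

theorem endgame_releases_within {Λ : Type*} (step : Λ → Λ → Prop) (pole sigma : Λ → ℕ)
    (hσ : SigmaStep step pole sigma) :
    ∀ n, ∀ L, pole L = 1 → sigma L < n → ∃ L', stepsTo step n L L' ∧ pole L' = 0 := by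
  intro n
  induction n with
  | zero => intro L _ h; exact absurd h (Nat.not_lt_zero _)
  | succ n ih =>
    intro L hL hlt
    obtain ⟨L', hs, h⟩ := hσ L hL
    rcases h with h0 | ⟨h1, hσlt⟩
    · refine ⟨L', Or.inr ⟨L', hs, ?_⟩, h0⟩
      cases n with
      | zero => rfl
      | succ n => exact Or.inl rfl
    · obtain ⟨L'', hst, h0⟩ := ih L' h1 (by omega)
      exact ⟨L'', Or.inr ⟨L', hs, hst⟩, h0⟩

/-- THE TWO-PHASE WALK (proved from the two paper theorems as hypotheses): Theorem 7bis.3′ (`PhiDecreases` with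
release threshold `1`: Φ drops along the additive levels `N ≥ 2`) and Lemma 3.2 (`SigmaStep` at `N = 1`) together
take every level to a level of pole order `0` (`∂(T) ⊆ T`: the ring of constants `T^∂` is then the regular
dominated model of the smaller field, Part III §1) by a finite chain of admissible blow-ups. -/
theorem reaches_pole_zero {Λ : Type*} (step : Λ → Λ → Prop) (pole rk mu dplus sigma : Λ → ℕ)
    (hΦ : PhiDecreases step pole rk mu dplus 1) (hσ : SigmaStep step pole sigma) :
    ∀ L, ∃ L', Relation.ReflTransGen step L L' ∧ pole L' = 0 := by
  intro L
  obtain ⟨L', h1, h2⟩ := reaches_released_phi step pole rk mu dplus 1 hΦ L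
  rcases Nat.lt_or_ge (pole L') 1 with hlt | hge
  · exact ⟨L', h1, by omega⟩
  · have h1' : pole L' = 1 := by omega
    obtain ⟨L'', h3, h4⟩ := endgame_releases step pole sigma hσ L' h1'
    exact ⟨L'', h1.trans h3, h4⟩

/-- The same with the three step types of the canonical walk spelled out (7bis.3′ (B)/(M)/(NM)) and the endgame:
every level reaches pole order `0`.  This is the complete logical skeleton of «defectless descent at rung 1,
regime e = p» (workfile 7bis.4), all d; its four hypotheses are 5.1(i), 7.3 + 5.9, 5.8 and Lemma 3.2. -/
theorem reaches_pole_zero_of_cases {Λ : Type*} (step : Λ → Λ → Prop) (pole rk mu dplus sigma : Λ → ℕ)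
    (hB : ∀ L, 1 < pole L → rk L = 0 → ∃ L', step L L' ∧ pole L' < pole L)
    (hM : ∀ L, 1 < pole L → rk L ≠ 0 → mu L = 0 → ∃ L', step L L' ∧
      (pole L' < pole L ∨ (pole L' = pole L ∧
        (rk L' < rk L ∨ (rk L' = rk L ∧ mu L' = 0 ∧ dplus L' < dplus L)))))
    (hNM : ∀ L, 1 < pole L → rk L ≠ 0 → mu L ≠ 0 → ∃ L', step L L' ∧
      pole L' = pole L ∧ rk L' = rk L ∧ mu L' = 0)
    (hσ : SigmaStep step pole sigma) :
    ∀ L, ∃ L', Relation.ReflTransGen step L L' ∧ pole L' = 0 :=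
  reaches_pole_zero step pole rk mu dplus sigma (phiDecreases_of_cases step pole rk mu dplus 1 hB hM hNM) hσ

/-! ## rev 4 (lens-3 g12, supplement §6.15): THE ORBIT DISTANCE — termination WITH A STEP COUNT and WITHOUT
the rank–phase facts.

Paper side (supplement `Lines/valuative-constant-step-normalmodule-supp.md` §6.15, PROVED lattice algebra): at e = p put
d̃⁺(Λ) := Σ_{j mod p} d⁺(x^{-j}Λ) = n·p(p-1)/2 + p·K(Λ) (O3/O4 define the integer K ≥ 0, K ≤ d⁺); (B) and (NM) are point
blow-ups and keep K (O1); an (M)-step lowers K by exactly rk B₀ (O2); (NM) yields a maximal level with the same N and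
B₀ (5.8).  Below these are the three hypotheses `hB`, `hM`, `hNM` on an abstract step relation, with `K` a primitive;
the conclusion is Theorem 7bis.3″: a level of pole order `N` reaches pole order `≤ 1` within `N + 2K - 1` steps.  The
rank `rk` enters only through `rk ≠ 0` and the drop `K' + rk ≤ K` — no monotonicity of `rk`, no `r' = r ⇒ maximal`. -/

section OrbitDistance

variable {Λ : Type*} (step : Λ → Λ → Prop) (pole rk mu K : Λ → ℕ)

/-- One unit of credit at a MAXIMAL additive level with `B₀ ≠ 0` (the next step is an (M)-step, which pays it back). -/
def credit (L : Λ) : ℕ := if 2 ≤ pole L ∧ rk L ≠ 0 ∧ mu L = 0 then 1 else 0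

theorem credit_le_one (L : Λ) : credit pole rk mu L ≤ 1 := by
  unfold credit; split <;> omega

theorem credit_eq_one {L : Λ} (h1 : 2 ≤ pole L) (h2 : rk L ≠ 0) (h3 : mu L = 0) : credit pole rk mu L = 1 := by
  unfold credit; rw [if_pos ⟨h1, h2, h3⟩]

theorem credit_eq_zero_of_rk {L : Λ} (h : rk L = 0) : credit pole rk mu L = 0 := by
  unfold credit; rw [if_neg (fun h' => h'.2.1 h)]

theorem credit_eq_zero_of_mu {L : Λ} (h : mu L ≠ 0) : credit pole rk mu L = 0 := by
  unfold credit; rw [if_neg (fun h' => h h'.2.2)]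

/-- THEOREM 7bis.3″ (abstract form, proved): the amortised potential `pole + 2K - credit` pays for every step. -/
theorem orbit_terminates_within
    (hB : ∀ L, 2 ≤ pole L → rk L = 0 → ∃ L', step L L' ∧ pole L' < pole L ∧ K L' = K L)
    (hM : ∀ L, 2 ≤ pole L → rk L ≠ 0 → mu L = 0 → ∃ L', step L L' ∧ pole L' ≤ pole L ∧ K L' + rk L ≤ K L)
    (hNM : ∀ L, 2 ≤ pole L → rk L ≠ 0 → mu L ≠ 0 →
      ∃ L', step L L' ∧ pole L' = pole L ∧ K L' = K L ∧ rk L' ≠ 0 ∧ mu L' = 0) :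
    ∀ n, ∀ L, pole L + 2 * K L ≤ n + 1 + credit pole rk mu L → ∃ L', stepsTo step n L L' ∧ pole L' ≤ 1 := by
  intro n
  induction n with
  | zero =>
    intro L h
    have hc := credit_le_one pole rk mu L
    by_cases hp : pole L ≤ 1
    · exact ⟨L, rfl, hp⟩
    · -- pole ≥ 2 forces pole + 2K ≥ 2 > 0 + 1 + credit unless credit = 1 and K = 0; then (M) gives K' + rk ≤ 0, rk ≠ 0: absurd
      exfalso
      have h2 : 2 ≤ pole L := by omega
      by_cases hr : rk L = 0
      · have := credit_eq_zero_of_rk pole rk mu (L := L) hr; omega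
      · by_cases hm : mu L = 0
        · obtain ⟨L', _, _, hK⟩ := hM L h2 hr hm
          have : credit pole rk mu L = 1 := credit_eq_one pole rk mu h2 hr hm
          omega
        · have := credit_eq_zero_of_mu pole rk mu (L := L) hm; omega
  | succ n ih =>
    intro L h
    by_cases hp : pole L ≤ 1
    · exact ⟨L, Or.inl rfl, hp⟩
    · have h2 : 2 ≤ pole L := by omega
      by_cases hr : rk L = 0
      · -- (B): pole drops, K kept; credit L = 0
        obtain ⟨L', hs, hlt, hK⟩ := hB L h2 hr
        have hc0 := credit_eq_zero_of_rk pole rk mu (L := L) hr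
        have hc' : 0 ≤ credit pole rk mu L' := Nat.zero_le _
        obtain ⟨L'', hst, hp''⟩ := ih L' (by omega)
        exact ⟨L'', Or.inr ⟨L', hs, hst⟩, hp''⟩
      · by_cases hm : mu L = 0
        · -- (M): K drops by rk ≥ 1, pole does not rise; credit L = 1 is paid back
          obtain ⟨L', hs, hle, hK⟩ := hM L h2 hr hm
          have hc1 := credit_eq_one pole rk mu h2 hr hm
          have hrk : 1 ≤ rk L := Nat.pos_of_ne_zero hr
          have hc' : 0 ≤ credit pole rk mu L' := Nat.zero_le _
          obtain ⟨L'', hst, hp''⟩ := ih L' (by omega)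
          exact ⟨L'', Or.inr ⟨L', hs, hst⟩, hp''⟩
        · -- (NM): everything kept, the successor is maximal with rk ≠ 0, so it carries credit 1
          obtain ⟨L', hs, hpo, hK, hr', hm'⟩ := hNM L h2 hr hm
          have hc0 := credit_eq_zero_of_mu pole rk mu (L := L) hm
          have hc1 : credit pole rk mu L' = 1 := credit_eq_one pole rk mu (by omega) hr' hm'
          obtain ⟨L'', hst, hp''⟩ := ih L' (by omega)
          exact ⟨L'', Or.inr ⟨L', hs, hst⟩, hp''⟩

/-- COROLLARY (7bis.3″, the count): from any level, pole order `≤ 1` is reached within `pole + 2K - 1` admissible steps;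
with O4 (`K ≤ d⁺`) within `N₀ + 2d⁺₀ - 1`. -/
theorem orbit_reaches_log_within
    (hB : ∀ L, 2 ≤ pole L → rk L = 0 → ∃ L', step L L' ∧ pole L' < pole L ∧ K L' = K L)
    (hM : ∀ L, 2 ≤ pole L → rk L ≠ 0 → mu L = 0 → ∃ L', step L L' ∧ pole L' ≤ pole L ∧ K L' + rk L ≤ K L)
    (hNM : ∀ L, 2 ≤ pole L → rk L ≠ 0 → mu L ≠ 0 →
      ∃ L', step L L' ∧ pole L' = pole L ∧ K L' = K L ∧ rk L' ≠ 0 ∧ mu L' = 0)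
    (dplus : Λ → ℕ) (hO4 : ∀ L, K L ≤ dplus L) :
    ∀ L, ∃ L', stepsTo step (pole L + 2 * dplus L - 1) L L' ∧ pole L' ≤ 1 := by
  intro L
  have hc : 0 ≤ credit pole rk mu L := Nat.zero_le _
  obtain ⟨L', hst, hp⟩ :=
    orbit_terminates_within step pole rk mu K hB hM hNM (pole L + 2 * K L - 1) L (by omega)
  have hKd := hO4 L
  exact ⟨L', stepsTo_mono step (by omega) hst, hp⟩

/-- And qualitative termination (7bis.3″ ⇒ the conclusion of 7bis.3′ with threshold 1), for the two-phase walk. -/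
theorem orbit_reaches_log
    (hB : ∀ L, 2 ≤ pole L → rk L = 0 → ∃ L', step L L' ∧ pole L' < pole L ∧ K L' = K L)
    (hM : ∀ L, 2 ≤ pole L → rk L ≠ 0 → mu L = 0 → ∃ L', step L L' ∧ pole L' ≤ pole L ∧ K L' + rk L ≤ K L)
    (hNM : ∀ L, 2 ≤ pole L → rk L ≠ 0 → mu L ≠ 0 →
      ∃ L', step L L' ∧ pole L' = pole L ∧ K L' = K L ∧ rk L' ≠ 0 ∧ mu L' = 0) :
    ∀ L, ∃ L', Relation.ReflTransGen step L L' ∧ pole L' ≤ 1 := by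
  -- stepsTo n ⊆ ReflTransGen
  have lift : ∀ n (L L' : Λ), stepsTo step n L L' → Relation.ReflTransGen step L L' := by
    intro n
    induction n with
    | zero => intro L L' h; exact h ▸ Relation.ReflTransGen.refl
    | succ n ih =>
      intro L L' h
      rcases h with h | ⟨M, hs, hM⟩
      · exact h ▸ Relation.ReflTransGen.refl
      · exact Relation.ReflTransGen.head hs (ih M L' hM)
  intro L
  have hc : 0 ≤ credit pole rk mu L := Nat.zero_le _
  obtain ⟨L', hst, hp⟩ :=
    orbit_terminates_within step pole rk mu K hB hM hNM (pole L + 2 * K L) L (by omega)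
  exact ⟨L', lift _ L L' hst, hp⟩

end OrbitDistance

end Summit.ResolutionOfSingularities.ResolutionOfSingularities.Cruxes.DescentPerfectToAll.ConormalWalk
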